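import Summits.RiemannHypothesis.RiemannHypothesis.Theses.RuelleBand
import Literature.Barriers.RiemannHypothesis.BohrDenseValuesProofs
import Literature.Barriers.RiemannHypothesis.BohrDenseValuesVoronin
import HarnessLib

/-!
# `ZetaWeakRecurrence` (crux stmt-RiemannHypothesis-18110, route RuelleBand) — the density scale is exhausted

Negative-side support file of the crux disprover (cdisprove seat, cycle 1). TIGHTNESS of the crux towards
its natural strengthenings by a DENSITY of returns. The crux WR asks only that the set of `ε`-returning shifts
`R(D, ε) = {τ : max_D |ζ(·+iτ) − ζ| < ε}` be UNBOUNDED for every closed disc `D` of the open strip and every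
`ε`. Bagchi's theorem as printed by Steuding (Thm. 8.3; tree `riemannHypothesis_iff_strongRecurrence_of_Voronin`,
proved) says that asking for positive LOWER density of `R(D, ε)` is RH itself. Bagchi's ORIGINAL statement
(Acta Math. Hung. 50 (1987); see Sourmelidis, Proc. AMS 153 (2025) = arXiv:2308.07031, §2, "Bagchi proves only
(1) ⟺ (3)") is the formally WEAKER positive-UPPER-density (`limsup`) form — and it is RH as well:

* `not_posUpperDensity_of_generated_zeros` — a set of shifts each of which generates a zero of `ζ` within `δ`
  of `ξ + iτ` (`1/2 < Re ξ − δ`, `Re ξ + δ ≤ 1`) has upper density ZERO: the counting of Steuding's proof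
  (tree `volume_inter_Icc_le_of_generated_zeros`) against `N(σ, T) = o(T)` for `σ > 1/2` (tree
  `zetaZeroCountRe_le_mul_of_half_lt`, from Ingham's density estimate, proved) works at EVERY large height,
  so a `limsup` suffices;
* `riemannZeta_ne_zero_of_upperRecurrence` — positive upper density of `R(D, ε)` for all discs and all `ε`
  forces `ζ ≠ 0` on `Re s > 1/2` (Rouché about an off-line zero, tree `exists_zero_near_shift`);
* `riemannHypothesis_iff_upperRecurrence` — hence `limsup`-recurrence ⟺ RH ⟺ `liminf`-recurrence.

So every ASYMPTOTIC-DENSITY strengthening of the crux is RH verbatim: between them and WR only the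
Banach-density form (open) remains; WR is the bottom of the scale. [cite: Steuding2007, Thm. 8.3]
-/

noncomputable section

open Complex Set Metric Filter Topology MeasureTheory
open scoped ENNReal

namespace Summit.RiemannHypothesis.RiemannHypothesis.Theorems.ZetaWeakRecurrence.Negative

open Summit.RiemannHypothesis.RiemannHypothesis.Theses.RuelleBand
open Literature.Barriers.RiemannHypothesis Literature.NumberTheory.LFunctions

/-- **Generating shifts have UPPER density zero.** If every `τ ∈ A` generates a zero `ρ` of `ζ` with
`|ρ − ξ − iτ| < δ`, where `1/2 < Re ξ − δ` and `Re ξ + δ ≤ 1`, then `A` does not have positive upper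
density: `meas(A ∩ [0,T]) ≤ |Im ξ| + δ + 2δ · N(Re ξ − δ, T + |Im ξ| + δ)` at EVERY height `T`
(tree `volume_inter_Icc_le_of_generated_zeros`) and `N(σ, T) = o(T)` for `σ > 1/2`
(tree `zetaZeroCountRe_le_mul_of_half_lt`). [cite: Steuding2007, Thm. 8.3 (proof)] -/
theorem not_posUpperDensity_of_generated_zeros {ξ : ℂ} {δ : ℝ} (hδpos : 0 < δ)
    (hσ₀ : 1 / 2 < ξ.re - δ) (hre : ξ.re + δ ≤ 1) {A : Set ℝ}
    (hgen : ∀ τ ∈ A, ∃ ρ : ℂ, riemannZeta ρ = 0 ∧ dist ρ (ξ + τ * I) < δ) :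
    ¬ ∃ c : ℝ, 0 < c ∧ ∀ T₀ : ℝ, ∃ T : ℝ, T₀ ≤ T ∧ ENNReal.ofReal (c * T) ≤ volume (A ∩ Icc 0 T) := by
  rintro ⟨c, hc, hA⟩
  -- density `o(T)` at `σ₀ = Re ξ − δ > 1/2`, with `κ = c/(4δ)`
  obtain ⟨T₁, hT₁⟩ := zetaZeroCountRe_le_mul_of_half_lt hσ₀ (by linarith)
    (div_pos hc (by linarith : (0 : ℝ) < 4 * δ))
  set B : ℝ := |ξ.im| + δ with hB
  have hBpos : 0 < B := by rw [hB]; positivity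
  -- a large height at which the upper density is witnessed
  obtain ⟨T, hT₂, hlow⟩ := hA (max T₁ 0 + B * (2 / c + 1) + 1)
  have hBc : 0 ≤ B * (2 / c + 1) := by positivity
  have hTT₁ : T₁ ≤ T + B := by linarith [le_max_left T₁ 0]
  have hT0 : 0 ≤ T := by linarith [le_max_right T₁ 0]
  have hTgt : B * (2 / c + 1) < T := by linarith [le_max_right T₁ 0]
  have hup := volume_inter_Icc_le_of_generated_zeros hre hgen T
  set Z := (zetaZeroBox_finite (ξ.re - δ) (T + |ξ.im| + δ)).toFinset with hZ
  have hcard : (Z.card : ℝ) ≤ c / (4 * δ) * (T + B) := by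
    have h1 : Z.card ≤ zetaZeroCountRe (ξ.re - δ) (T + |ξ.im| + δ) :=
      card_le_zetaZeroCountRe fun ρ hρ ↦ (Set.Finite.mem_toFinset _).1 hρ
    have h2 := hT₁ (T + B) hTT₁
    have hTB : T + |ξ.im| + δ = T + B := by rw [hB, add_assoc]
    have h1' : (Z.card : ℝ) ≤ (zetaZeroCountRe (ξ.re - δ) (T + |ξ.im| + δ) : ℝ) := by
      exact_mod_cast h1
    rw [hTB] at h1'
    exact h1'.trans h2
  have hZnn : (0 : ℝ) ≤ (Z.card : ℝ) * (2 * δ) :=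
    mul_nonneg (Nat.cast_nonneg _) (by linarith)
  have hconv : ENNReal.ofReal (|ξ.im| + δ) + (Z.card : ℝ≥0∞) * ENNReal.ofReal (2 * δ) =
      ENNReal.ofReal (B + (Z.card : ℝ) * (2 * δ)) := by
    rw [ENNReal.ofReal_add hBpos.le hZnn, ENNReal.ofReal_mul (Nat.cast_nonneg _),
      ENNReal.ofReal_natCast, hB]
  have hreal : c * T ≤ B + Z.card * (2 * δ) := by
    have h := hlow.trans hup
    rw [hconv, ENNReal.ofReal_le_ofReal_iff (add_nonneg hBpos.le hZnn)] at h
    exact h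
  have hfinal : c * T ≤ B + c / (4 * δ) * (T + B) * (2 * δ) := by
    have := mul_le_mul_of_nonneg_right hcard (by linarith : (0 : ℝ) ≤ 2 * δ)
    linarith
  have hsimp : c / (4 * δ) * (T + B) * (2 * δ) = c / 2 * (T + B) := by
    field_simp
    ring
  rw [hsimp] at hfinal
  have hkey : c / 2 * (B * (2 / c + 1)) = B * (1 + c / 2) := by
    field_simp
  have h3 : c / 2 * T ≤ B * (1 + c / 2) := by linarith
  have h4 : c / 2 * (B * (2 / c + 1)) < c / 2 * T := mul_lt_mul_of_pos_left hTgt (by linarith)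
  rw [hkey] at h4
  linarith

/-- **Upper-density recurrence forces `ζ ≠ 0` on `Re s > 1/2`** (Bagchi's original "(3) ⟹ (1)"): if for
every `ε > 0` and every closed disc of the open strip the `ε`-returning shifts have positive UPPER density,
then `ζ(s) ≠ 0` for `Re s > 1/2`, `s ≠ 1`. An off-line zero `ξ` is isolated; with `ε = min_{|w−ξ|=δ} |ζ(w)|`
every returning shift generates (Rouché, tree `exists_zero_near_shift`) a zero within `δ` of `ξ + iτ`, and
`not_posUpperDensity_of_generated_zeros` applies. [cite: Bagchi1987, main theorem] [cite: Steuding2007, Thm. 8.3] -/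
theorem riemannZeta_ne_zero_of_upperRecurrence
    (hrec : ∀ ε : ℝ, 0 < ε → ∀ z : ℂ, 1 / 2 < z.re → z.re < 1 →
      ∀ r : ℝ, 0 < r → r < min (z.re - 1 / 2) (1 - z.re) →
        ∃ c : ℝ, 0 < c ∧ ∀ T₀ : ℝ, ∃ T : ℝ, T₀ ≤ T ∧ ENNReal.ofReal (c * T) ≤
          volume ({τ : ℝ | ∀ s ∈ closedBall z r, ‖riemannZeta (s + τ * I) - riemannZeta s‖ < ε} ∩
            Icc 0 T)) :
    ∀ s : ℂ, 1 / 2 < s.re → s ≠ 1 → riemannZeta s ≠ 0 := by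
  intro ξ hξθ hξ1 hξ0
  have hξre1 : ξ.re < 1 := lt_of_not_ge fun h ↦ riemannZeta_ne_zero_of_one_le_re h hξ0
  -- Step 1: `ξ` is an isolated zero
  have han : AnalyticAt ℂ riemannZeta ξ := analyticOn_riemannZeta ξ hξ1
  have hev : ∀ᶠ w in 𝓝[≠] ξ, riemannZeta w ≠ 0 := by
    rcases han.eventually_eq_zero_or_eventually_ne_zero with h0 | hne
    · exfalso
      have h2 : riemannZeta 2 = 0 :=
        analyticOn_riemannZeta.eqOn_zero_of_preconnected_of_eventuallyEq_zero
          (isConnected_compl_singleton_of_one_lt_rank (by simp) (1 : ℂ)).isPreconnected hξ1 h0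
          (show (2 : ℂ) ∈ ({1}ᶜ : Set ℂ) by norm_num)
      exact riemannZeta_ne_zero_of_one_le_re (s := 2) (by norm_num) h2
    · exact hne
  obtain ⟨δ₁, hδ₁, hpunct⟩ : ∃ δ₁ > 0, ∀ w : ℂ, dist w ξ < δ₁ → w ≠ ξ → riemannZeta w ≠ 0 := by
    rw [eventually_nhdsWithin_iff, Metric.eventually_nhds_iff] at hev
    obtain ⟨δ₁, hδ₁, h⟩ := hev
    exact ⟨δ₁, hδ₁, fun w hw hne ↦ h hw hne⟩
  -- Step 2: a radius `δ` (inside the punctured disc and the strip)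
  set δ : ℝ := min (δ₁ / 2) (min (ξ.re - 1 / 2) (1 - ξ.re) / 2) with hδdef
  have hmpos : 0 < min (ξ.re - 1 / 2) (1 - ξ.re) := lt_min (by linarith) (by linarith)
  have hδpos : 0 < δ := by rw [hδdef]; exact lt_min (by linarith) (by linarith)
  have hδ₁' : δ < δ₁ := by
    rw [hδdef]; exact (min_le_left _ _).trans_lt (by linarith)
  have hδmin : δ < min (ξ.re - 1 / 2) (1 - ξ.re) := by
    rw [hδdef]; exact (min_le_right _ _).trans_lt (by linarith)
  have hδθ : δ < ξ.re - 1 / 2 := hδmin.trans_le (min_le_left _ _)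
  have hδ1 : δ < 1 - ξ.re := hδmin.trans_le (min_le_right _ _)
  -- Step 3: `ε := min_{|w−ξ|=δ} |ζ(w)| > 0`
  have hcont : ContinuousOn (fun w ↦ ‖riemannZeta w‖) (sphere ξ δ) := by
    refine ContinuousOn.norm fun w hw ↦ ?_
    have hw1 : w ≠ 1 := by
      intro h
      rw [h, mem_sphere, dist_eq_norm] at hw
      have := abs_re_le_norm (1 - ξ)
      rw [hw, sub_re, one_re] at this
      rw [abs_le] at this
      linarith [this.1]
    exact (differentiableAt_riemannZeta hw1).continuousAt.continuousWithinAt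
  obtain ⟨w₀, hw₀, hmin⟩ := (isCompact_sphere ξ δ).exists_isMinOn
    (NormedSpace.sphere_nonempty.2 hδpos.le) hcont
  set ε : ℝ := ‖riemannZeta w₀‖ with hεdef
  have hεpos : 0 < ε := by
    rw [hεdef, norm_pos_iff]
    refine hpunct w₀ ?_ ?_
    · rw [mem_sphere.1 hw₀]; exact hδ₁'
    · intro h
      have := mem_sphere.1 hw₀
      rw [h, dist_self] at this
      exact hδpos.ne this
  have hεle : ∀ w ∈ sphere ξ δ, ε ≤ ‖riemannZeta w‖ := fun w hw ↦ hmin hw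
  -- Step 4: every returning shift generates a zero (Rouché)
  have hgen : ∀ τ ∈ {τ : ℝ | ∀ s ∈ closedBall ξ δ,
      ‖riemannZeta (s + τ * I) - riemannZeta s‖ < ε},
      ∃ ρ : ℂ, riemannZeta ρ = 0 ∧ dist ρ (ξ + τ * I) < δ :=
    fun τ hτ ↦ exists_zero_near_shift hξ0 hδpos (by linarith) hεle hτ
  -- Step 5: the return set cannot have positive upper density
  exact not_posUpperDensity_of_generated_zeros hδpos (by linarith) (by linarith) hgen
    (hrec ε hεpos ξ hξθ hξre1 δ hδpos hδmin)

/-- **The density scale above the crux is exhausted by RH**: positive-UPPER-density recurrence of `ζ` on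
every closed disc of the open strip (Bagchi's original (3)) ⟺ RH (⟺ positive-LOWER-density recurrence,
tree `riemannHypothesis_iff_strongRecurrence_of_Voronin`). `→`: RH gives lower density (Voronin), hence
upper; `←`: `riemannZeta_ne_zero_of_upperRecurrence` and `QuasiRH(1/2) ⟺ RH`
(tree `quasiRiemannHypothesis_one_half_iff_holds`). The crux WR (unbounded return set, no density) is
the first rung below this equivalence. [cite: Bagchi1987, main theorem] [cite: Steuding2007, Thm. 8.3] -/
theorem riemannHypothesis_iff_upperRecurrence :
    RiemannHypothesis ↔ ∀ ε : ℝ, 0 < ε → ∀ z : ℂ, 1 / 2 < z.re → z.re < 1 →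
      ∀ r : ℝ, 0 < r → r < min (z.re - 1 / 2) (1 - z.re) →
        ∃ c : ℝ, 0 < c ∧ ∀ T₀ : ℝ, ∃ T : ℝ, T₀ ≤ T ∧ ENNReal.ofReal (c * T) ≤
          volume ({τ : ℝ | ∀ s ∈ closedBall z r, ‖riemannZeta (s + τ * I) - riemannZeta s‖ < ε} ∩
            Icc 0 T) := by
  constructor
  · intro h ε hε z hz hz' r hr hrmin
    obtain ⟨c, hc, T₀, hT⟩ :=
      (riemannHypothesis_iff_strongRecurrence_of_Voronin Voronin1975_universality_holds).1 h ε hε z hz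
        hz' r hr hrmin
    exact ⟨c, hc, fun T₁ => ⟨max T₀ T₁, le_max_right _ _, hT _ (le_max_left _ _)⟩⟩
  · intro hrec
    exact quasiRiemannHypothesis_one_half_iff_holds.1
      ((forall_ne_zero_iff_quasiRiemannHypothesis (1 / 2)).1
        (riemannZeta_ne_zero_of_upperRecurrence hrec))

end Summit.RiemannHypothesis.RiemannHypothesis.Theorems.ZetaWeakRecurrence.Negative

end
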